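import Summits.NavierStokesRegularity.FluidComputer.BlockEnergyTransport
import Summits.NavierStokesRegularity.FluidComputer.LevelEnergyFloor
import Summits.NavierStokesRegularity.FluidComputer.TerminalWindowFloor
import Literature.Analysis.FluidPDE.CheskidovDaiNonlinear
import Literature.Analysis.FluidPDE.TaoQuantitativeLPPointwise
import HarnessLib

/-!
# Fluid computer — L12: the TRANSFER (feeding) FLOOR of a blow-up, and its locality

HONEST FRAMING (cell `pub-fluidc`, verbatim): *low prior, high value-of-information experiment on Tao's
machine paradigm; NOT a claim that NS blows up.* Theorem side of the cell (the floors every cascade design must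
respect); nothing here is evidence of blow-up, and no statement about any fixed finite set of levels is made.

The rung's level dictionary has, so far, an AMPLITUDE floor (`LevelReynoldsFloor`: `‖Δ̇_j u(t)‖_∞ > c ν 2^j` at
infinitely many levels), an ENERGY floor (`LevelEnergyFloor`: `‖Δ̇_j u(t)‖₂ > c ν 2^{-j/2} / C` at infinitely many
levels), a FLATNESS floor, CLOCK / OCCUPATION floors and the saturation relay L5–L11 (`TerminalWindowFloor`,
`SaturationRelay`, `SaturationHorizon`). All of them constrain the STATE of the high levels. This file adds the floor
on the PROCESS that fills them — the nonlinear transfer into a block, `N_j(w) := ∫ ⟪Δ̇_j w, Δ̇_j ((w·∇) w)⟫` — using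
the transported block energy balance `‖Δ̇_j u(t)‖₂² ≤ ‖Δ̇_j u(s)‖₂² + 2 ∫⁻_{(s,t]} (−N_j(u(τ)))⁺ dτ` of
`BlockEnergyTransport.blockL2_sq_le_add_transfer` (Cheskidov–Shvydkoy 2010 (8) carried to the maximal solution by
Leray's regular local solutions and weak–strong uniqueness) and the energy floor:

* `transfer_floor` (**L12 — THE TRANSFER FLOOR**) — there is an absolute `c > 0` such that for every maximal
  smooth solution `(u, p)` with finite lifespan `T`, Leray–Hopf from `u 0`, and every `t₀ ∈ [0, T)`: at INFINITELY
  MANY levels `j`, `2^j ∫⁻_{(t₀,T)} (−N_j(u(τ)))⁺ dτ ≥ c ν²`. The energy floor is met at a time `t_j` of the window at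
  infinitely many levels, the block was (in the weighted sense `∑_l 4^l ‖Δ̇_l u(s₀)‖₂² < ∞`) empty at a fixed earlier
  time `s₀`, and nothing but the nonlinear transfer INTO the block can have filled it: NO LEVEL REACHES THE FLOOR
  UNFED, and the cumulative feeding of level `j` inside every terminal window is at least the kinetic energy of one
  eddy of width `2^{-j}` at the floor velocity `c ν 2^j`.
* `transfer_floor_local` (**L12′ — LOCALITY OF THE FEEDING**) — the same floor with `(−N_j)⁺` replaced by the
  Cheskidov–Dai low-mode bound of the block balance (`enorm_integral_inner_blockFn_convect_le_lowMode`, arXiv:1507.06611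
  §3.1 (3.6), block by block; Fourier-support locality of the Littlewood–Paley pieces): with ONE absolute constant `A`,
  `c ν² ≤ 2^j ∫⁻_{(t₀,T)} A·( a_j ∑_{|m|≤2} a_{j+m} T_{j+m} + s_j Q_j ) dτ` at infinitely many `j`, where
  `a_l = ‖Δ̇_l u(τ)‖₂`, `s_l = ‖Δ̇_l u(τ)‖_∞`, `T_l = ∑_{l' ≤ l-3} 2^{l'} s_{l'}` (the Lipschitz size of ALL COARSER levels:
  the strain / sweep acting on the local pair) and `Q_j = ∑_{l ≥ j-4, |m| ≤ 2} a_l 2^{l+m} a_{l+m}` (wavenumber-weighted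
  energy PAIRS of comparable-or-finer levels). Reading: the feeding of level `j` runs through exactly two channels —
  [own `L²` amplitude × a NEIGHBOUR's (`|m| ≤ 2`) × coarse strain] and [own sup amplitude × comparable-or-finer energy
  pairs] — and EVERY term carries the block's own amplitude (`a_j` or `s_j`) as a factor: an empty level is not filled
  from a distance, and the coarse levels enter only through their Lipschitz norm multiplying a local pair. This is the
  theorem-currency form of the cell's "hand-off is local" bookkeeping; it says nothing about sufficiency.

* `blockL2_sq_le_add_local` (**L12″ — THE TRANSFER CEILING**, appended) — for ALL `0 < s ≤ t < T` and EVERY level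
  `j`: `‖Δ̇_j u(t)‖₂² ≤ ‖Δ̇_j u(s)‖₂² + 2 ∫⁻_{(s,t]} A·( a_j ∑_{|m|≤2} a_{j+m} T_{j+m} + s_j Q_j ) dτ` — the energy handed
  into a level between two times is at most what the two local channels carry; the block's own amplitude is a factor
  of every term (growth at the rate set by the neighbours and the coarse strain, never a jump fed from a distance).

0 sorry; no new definitions, no named facts (every PDE input is a discharged theorem of the tree:
`BlockEnergyTransport.blockL2_sq_le_add_transfer` / `isSmoothL2Field_slice_of_maximal`,
`TerminalWindowFloor.exists_restart`, `LevelEnergyFloor.level_energy_frequently_gt`,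
`enorm_integral_inner_blockFn_convect_le_lowMode`).

## References

* A. Cheskidov, R. Shvydkoy, *The regularity of weak solutions of the 3D Navier–Stokes equations in `B^{-1}_{∞,∞}`*,
  Arch. Ration. Mech. Anal. 195 (2010) 159–169 = arXiv:0708.3067, Lemma 3.2 and its proof, (8). [CheskidovShvydkoy2010]
* A. Cheskidov, M. Dai, *Regularity criteria for the 3D Navier–Stokes and MHD equations*, arXiv:1507.06611 =
  Proc. Edinburgh Math. Soc. (2025), §3.1, (3.6). [CheskidovDai2015]
* A. Cheskidov, P. Constantin, S. Friedlander, R. Shvydkoy, *Energy conservation and Onsager's conjecture for the Euler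
  equations*, Nonlinearity 21 (2008) 1233–1252 (locality of the Littlewood–Paley energy flux — context).
-/

noncomputable section

open MeasureTheory Set Function Filter Topology TemperedDistribution
open scoped ENNReal NNReal SchwartzMap RealInnerProductSpace
open Literature.Analysis.FluidPDE Literature.Analysis.FunctionSpaces
open Summit.NavierStokesRegularity.FluidComputer.BlockEnergyTransport

namespace Summit.NavierStokesRegularity.FluidComputer.LevelTransferFloor

/-! ## L12 — the transfer floor -/

/-- **L12 — the TRANSFER (feeding) FLOOR.** There is an absolute `c > 0` such that for every `ν > 0`, `T > 0`, every
maximal smooth solution `(u, p)` of the unforced Navier–Stokes system on `ℝ³ × [0, T)` (classical on `[0, T)`, no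
classical continuation past `T`) which is a Leray–Hopf weak solution from `u 0`, and every `t₀ ∈ [0, T)`: at
INFINITELY MANY dyadic levels `j`,
`c ν² ≤ 2^j ∫⁻_{(t₀, T)} (−N_j(u(τ)))⁺ dτ`, `N_j(w) := ∫ ⟪Δ̇_j w, Δ̇_j ((w·∇)w)⟫`
(the lower Lebesgue integral of the positive part of the nonlinear transfer rate INTO block `j` over the terminal
window). Proof: restart at a good time `s₀ ∈ (t₀, T)` (`TerminalWindowFloor.exists_restart`); the energy floor of the
translate (`LevelEnergyFloor.level_energy_frequently_gt`, Cheskidov–Shvydkoy + Bernstein) gives at infinitely many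
levels a time `t_j ∈ (s₀, T)` with `(c₁ν)² < C² 2^j ‖Δ̇_j u(t_j)‖₂²`; the covered transport inequality
`blockL2_sq_le_add_transfer` on `[s₀, t_j]` bounds this by `C² 2^j ‖Δ̇_j u(s₀)‖₂² + 2 C² 2^j ∫⁻ (−N_j)⁺`, and the first
term tends to `0` because `∑_l 4^l ‖Δ̇_l u(s₀)‖₂² < ∞` (the slice at `s₀` is a smooth `L²` field). The constant is
`c = c₁² / (4 (C² + 1))`. In cascade words: a blow-up realised through levels `k_j = 2^j` must FEED each of
infinitely many levels, inside every terminal window, at least the energy `c ν² k_j^{-1}` through the nonlinear term —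
no level meets the floor on stored energy. Necessity only. [cite: CheskidovShvydkoy2010, Lemma 3.2 (proof, (8))] -/
theorem transfer_floor :
    ∃ c : ℝ, 0 < c ∧ ∀ (ν T : ℝ), 0 < ν → 0 < T →
      ∀ (u : ℝ → EuclideanSpace ℝ (Fin 3) → EuclideanSpace ℝ (Fin 3)) (p : ℝ → EuclideanSpace ℝ (Fin 3) → ℝ),
      IsMaximalSmoothSolution ν 0 u p T → IsLerayHopfOn T ν 0 (u 0) u →
      ∀ t₀ ∈ Ico 0 T, ∃ᶠ j : ℕ in atTop,
        ENNReal.ofReal (c * ν ^ 2) ≤ (2 : ℝ≥0∞) ^ j *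
          ∫⁻ τ in Ioo t₀ T, ENNReal.ofReal
            (-(∫ x, ⟪blockFn (j : ℤ) (u τ) x, blockFn (j : ℤ) (convect (u τ) (u τ)) x⟫)) := by
  haveI : Fact (1 ≤ (2 : ℝ≥0∞)) := ⟨one_le_two⟩
  obtain ⟨c, C, hc, H⟩ := LevelEnergyFloor.level_energy_frequently_gt
  refine ⟨c ^ 2 / (4 * ((C : ℝ) ^ 2 + 1)), by positivity, fun ν T hν hT u p hmax hLH t₀ ht₀ => ?_⟩
  obtain ⟨U, hU⟩ := LambdaFrontier.exists_sliceDistribution hLH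
  obtain ⟨s₀, hs₀, hmaxs, hLHs, hUs⟩ := TerminalWindowFloor.exists_restart hν hmax hLH hU ht₀
  have hs₀T : s₀ ∈ Ioo 0 T := ⟨ht₀.1.trans_lt hs₀.1, hs₀.2⟩
  have hfreq := H ν (T - s₀) hν (sub_pos.2 hs₀.2) (fun t => u (t + s₀)) (fun t => p (t + s₀))
    (fun t => U (t + s₀)) hmaxs hLHs hUs
  -- the dyadic energy at `s₀` is finite
  set D : ℝ≥0∞ := dyadicF (u s₀) with hD
  have hw : IsSmoothL2Field (u s₀) := isSmoothL2Field_slice_of_maximal hν hT hmax hLH hs₀T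
  have hDtop : D ≠ ∞ := dyadicF_ne_top_of_rep (lpBounds (Fin 3)) hw EventuallyEq.rfl
  -- large levels
  set α : ℝ := (c * ν) ^ 2 with hα
  have hαpos : 0 < α := by positivity
  obtain ⟨J, hJ⟩ : ∃ J : ℕ, 2 * (C : ℝ) ^ 2 * D.toReal ≤ 2 ^ J * α := by
    obtain ⟨J, hJ⟩ := exists_nat_gt (2 * (C : ℝ) ^ 2 * D.toReal / α)
    refine ⟨J, ?_⟩
    have h1 : 2 * (C : ℝ) ^ 2 * D.toReal < J * α := by rwa [div_lt_iff₀ hαpos] at hJ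
    have h2 : (J : ℝ) ≤ 2 ^ J := by exact_mod_cast Nat.lt_two_pow_self.le
    nlinarith
  refine (hfreq.and_eventually (eventually_ge_atTop J)).mono ?_
  rintro j ⟨⟨t, ht, hlt⟩, hJj⟩
  -- the floor time in the window and the dictionary
  have ht'I : t + s₀ ∈ Ioo s₀ T := ⟨by linarith [ht.1], by linarith [ht.2]⟩
  have ht'c : t + s₀ ∈ Icc 0 T := ⟨hs₀T.1.le.trans ht'I.1.le, ht'I.2.le⟩
  have hdict : eLpNormDistrib 2 (lpBlock (j : ℤ) (U (t + s₀))) = blockL2 (u (t + s₀)) j :=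
    (hU (t + s₀) ht'c).eLpNormDistrib_lpBlock_eq_self (hLH.memLp (t + s₀) ht'c) (j : ℤ)
  rw [hdict] at hlt
  -- the transport inequality on `[s₀, t + s₀]` and the window
  set F : ℝ → ℝ≥0∞ := fun τ => ENNReal.ofReal
    (-(∫ x, ⟪blockFn (j : ℤ) (u τ) x, blockFn (j : ℤ) (convect (u τ) (u τ)) x⟫)) with hF
  set I : ℝ≥0∞ := ∫⁻ τ in Ioo t₀ T, F τ with hI
  have hcov := blockL2_sq_le_add_transfer hν hT hmax hLH hs₀T.1 ht'I.1.le ht'I.2 (j : ℤ)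
  have hIle : ∫⁻ τ in Ioc s₀ (t + s₀), F τ ≤ I :=
    lintegral_mono_set fun τ hτ => ⟨hs₀.1.trans hτ.1, hτ.2.trans_lt ht'I.2⟩
  have hcov' : blockL2 (u (t + s₀)) j ^ 2 ≤ blockL2 (u s₀) j ^ 2 + 2 * I :=
    hcov.trans (by gcongr)
  -- initial term: `(2^j ‖Δ̇_j u(s₀)‖₂)² ≤ D`
  have hB : ((2 : ℝ≥0∞) ^ j * blockL2 (u s₀) j) ^ 2 ≤ D := by
    have h := ENNReal.le_tsum (f := fun l : ℤ => ((2 : ℝ≥0∞) ^ l * blockL2 (u s₀) l) ^ 2) (j : ℤ)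
    simpa only [hD, dyadicF, dyadicSqSum, zpow_natCast] using h
  -- the trivial case
  by_cases hItop : I = ∞
  · rw [hItop, ENNReal.mul_top (pow_ne_zero _ two_ne_zero)]; exact le_top
  -- everything is finite: pass to `ℝ`
  have hA2top : blockL2 (u (t + s₀)) j ≠ ∞ :=
    (memLp_blockFn (j : ℤ) (hLH.memLp (t + s₀) ht'c) one_le_two).eLpNorm_ne_top
  have hB2top : blockL2 (u s₀) j ≠ ∞ :=
    (memLp_blockFn (j : ℤ) (hLH.memLp s₀ ⟨hs₀T.1.le, hs₀T.2.le⟩) one_le_two).eLpNorm_ne_top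
  set a : ℝ := (blockL2 (u (t + s₀)) j).toReal with ha
  set b : ℝ := (blockL2 (u s₀) j).toReal with hb
  set i : ℝ := I.toReal with hi
  set P : ℝ := (2 : ℝ) ^ j with hP
  have hPpos : 0 < P := by positivity
  have ha0 : 0 ≤ a := ENNReal.toReal_nonneg
  have hi0 : 0 ≤ i := ENNReal.toReal_nonneg
  -- (1) the floor: `α < C² P a²`
  have h1 : α < (C : ℝ) ^ 2 * P * a ^ 2 := by
    have hrt : ((2 : ℝ≥0∞) ^ ((j : ℝ) / 2)).toReal ^ 2 = P := by
      rw [← ENNReal.toReal_pow, ← ENNReal.rpow_natCast, ← ENNReal.rpow_mul,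
        show (j : ℝ) / 2 * ((2 : ℕ) : ℝ) = ((j : ℕ) : ℝ) by push_cast; ring, ENNReal.rpow_natCast,
        ENNReal.toReal_pow, ENNReal.toReal_ofNat]
    have hfin : (C : ℝ≥0∞) * (2 : ℝ≥0∞) ^ ((j : ℝ) / 2) * blockL2 (u (t + s₀)) j ≠ ∞ :=
      ENNReal.mul_ne_top (ENNReal.mul_ne_top ENNReal.coe_ne_top
        (ENNReal.rpow_ne_top_of_nonneg (by positivity) ENNReal.ofNat_ne_top)) hA2top
    have h := ENNReal.toReal_strict_mono hfin hlt
    rw [ENNReal.toReal_ofReal (by positivity), ENNReal.toReal_mul, ENNReal.toReal_mul, ENNReal.coe_toReal] at h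
    have hr0 : 0 ≤ ((2 : ℝ≥0∞) ^ ((j : ℝ) / 2)).toReal := ENNReal.toReal_nonneg
    have hcν : 0 < c * ν := mul_pos hc hν
    have h' : (c * ν) ^ 2 < ((C : ℝ) * ((2 : ℝ≥0∞) ^ ((j : ℝ) / 2)).toReal * a) ^ 2 :=
      pow_lt_pow_left₀ h hcν.le two_ne_zero
    calc α = (c * ν) ^ 2 := hα
      _ < ((C : ℝ) * ((2 : ℝ≥0∞) ^ ((j : ℝ) / 2)).toReal * a) ^ 2 := h'
      _ = (C : ℝ) ^ 2 * P * a ^ 2 := by rw [← hrt]; ring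
  -- (2) transport: `a² ≤ b² + 2 i`
  have h2 : a ^ 2 ≤ b ^ 2 + 2 * i := by
    have hfin : blockL2 (u s₀) j ^ 2 + 2 * I ≠ ∞ :=
      ENNReal.add_ne_top.2 ⟨ENNReal.pow_ne_top hB2top, ENNReal.mul_ne_top ENNReal.ofNat_ne_top hItop⟩
    have h := ENNReal.toReal_mono hfin hcov'
    rwa [ENNReal.toReal_pow, ENNReal.toReal_add (ENNReal.pow_ne_top hB2top)
      (ENNReal.mul_ne_top ENNReal.ofNat_ne_top hItop), ENNReal.toReal_pow, ENNReal.toReal_mul,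
      ENNReal.toReal_ofNat] at h
  -- (3) initial smallness: `P² b² ≤ D`
  have h3 : P ^ 2 * b ^ 2 ≤ D.toReal := by
    have h := ENNReal.toReal_mono hDtop hB
    rwa [ENNReal.toReal_pow, ENNReal.toReal_mul, ENNReal.toReal_pow, ENNReal.toReal_ofNat, mul_pow] at h
  -- (4) the level is large: `2 C² D ≤ P α`
  have h4 : 2 * (C : ℝ) ^ 2 * D.toReal ≤ P * α := by
    refine hJ.trans ?_
    have : (2 : ℝ) ^ J ≤ P := pow_le_pow_right₀ one_le_two hJj
    exact mul_le_mul_of_nonneg_right this hαpos.le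
  -- conclusion in `ℝ`
  have hreal : c ^ 2 / (4 * ((C : ℝ) ^ 2 + 1)) * ν ^ 2 ≤ P * i := by
    have hC0 : 0 ≤ (C : ℝ) ^ 2 := sq_nonneg _
    have hPb : (C : ℝ) ^ 2 * P * b ^ 2 ≤ α / 2 := by
      -- `C² P b² = C² (P² b²) / P ≤ C² D / P ≤ α / 2`
      have h5 : (C : ℝ) ^ 2 * (P ^ 2 * b ^ 2) ≤ (C : ℝ) ^ 2 * D.toReal := mul_le_mul_of_nonneg_left h3 hC0
      have h6 : (C : ℝ) ^ 2 * D.toReal ≤ P * α / 2 := by linarith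
      have h7 : P * ((C : ℝ) ^ 2 * P * b ^ 2) ≤ P * (α / 2) := by nlinarith
      exact le_of_mul_le_mul_left h7 hPpos
    have h8 : α < α / 2 + 2 * (C : ℝ) ^ 2 * (P * i) := by
      have h8a : (C : ℝ) ^ 2 * P * a ^ 2 ≤ (C : ℝ) ^ 2 * P * (b ^ 2 + 2 * i) :=
        mul_le_mul_of_nonneg_left h2 (mul_nonneg hC0 hPpos.le)
      nlinarith
    have h9 : α ≤ 4 * ((C : ℝ) ^ 2 + 1) * (P * i) := by nlinarith
    have h10 : c ^ 2 / (4 * ((C : ℝ) ^ 2 + 1)) * ν ^ 2 = α / (4 * ((C : ℝ) ^ 2 + 1)) := by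
      rw [hα]; ring
    rw [h10, div_le_iff₀ (by positivity)]
    linarith
  -- back to `ℝ≥0∞`
  calc ENNReal.ofReal (c ^ 2 / (4 * ((C : ℝ) ^ 2 + 1)) * ν ^ 2) ≤ ENNReal.ofReal (P * i) :=
      ENNReal.ofReal_le_ofReal hreal
    _ = (2 : ℝ≥0∞) ^ j * I := by
      rw [ENNReal.ofReal_mul hPpos.le, hP, ENNReal.ofReal_pow zero_le_two, ENNReal.ofReal_ofNat, hi,
        ENNReal.ofReal_toReal hItop]

/-! ## L12′ — locality of the feeding -/

/-- **L12′ — LOCALITY OF THE FEEDING (Cheskidov–Dai's low-mode form of the block balance).** There are an absolute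
`c > 0` and an absolute FINITE constant `A` (made of Littlewood–Paley constants only) such that for every `ν > 0`,
`T > 0`, every maximal smooth solution `(u, p)` of the unforced Navier–Stokes system on `ℝ³ × [0, T)` which is
Leray–Hopf from `u 0`, and every `t₀ ∈ [0, T)`: at INFINITELY MANY dyadic levels `j`,
`c ν² ≤ 2^j ∫⁻_{(t₀,T)} A · ( a_j(τ) ∑_{|m| ≤ 2} a_{j+m}(τ) T_{j+m}(τ) + s_j(τ) Q_j(τ) ) dτ`, where
`a_l(τ) = ‖Δ̇_l u(τ)‖₂` (`blockL2`), `s_l(τ) = ‖Δ̇_l u(τ)‖_∞` (`blockSup`),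
`T_l = ∑_{l' ≤ l-3} 2^{l'} s_{l'}` (`paraT` of the weighted sups — the Lipschitz size of all COARSER levels) and
`Q_j = ∑_{l ≥ j-4, |m| ≤ 2} a_l 2^{l+m} a_{l+m}` (`paraQ2` — wavenumber-weighted energy pairs of comparable or FINER
levels). This is `transfer_floor` combined with `‖N_j(w)‖ ≤ (A₁+A₂) a_j ∑_{|m|≤2} a_{j+m} T_{j+m} + A₃ s_j Q_j` for smooth
divergence-free `L²` fields (`enorm_integral_inner_blockFn_convect_le_lowMode`, the block-by-block form of
Cheskidov–Dai 2015 (3.6); locality = the Fourier supports of the Littlewood–Paley pieces), applicable slice by slice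
by `isSmoothL2Field_slice_of_maximal`. Reading: the feeding of a level runs through exactly two channels — the LOCAL
PAIR channel (own `L²` amplitude × a neighbour's, `|m| ≤ 2`, × the coarse strain) and the FINE PAIR channel (own sup
amplitude × comparable-or-finer energy pairs) — and every term carries the block's OWN amplitude as a factor: no level
is filled from a distance or from nothing. Necessity only; nothing about any fixed finite set of levels.
[cite: CheskidovDai2015, §3.1 (3.6)] -/
theorem transfer_floor_local :
    ∃ (c : ℝ) (A : ℝ≥0∞), 0 < c ∧ A ≠ ∞ ∧ ∀ (ν T : ℝ), 0 < ν → 0 < T →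
      ∀ (u : ℝ → EuclideanSpace ℝ (Fin 3) → EuclideanSpace ℝ (Fin 3)) (p : ℝ → EuclideanSpace ℝ (Fin 3) → ℝ),
      IsMaximalSmoothSolution ν 0 u p T → IsLerayHopfOn T ν 0 (u 0) u →
      ∀ t₀ ∈ Ico 0 T, ∃ᶠ j : ℕ in atTop,
        ENNReal.ofReal (c * ν ^ 2) ≤ (2 : ℝ≥0∞) ^ j *
          ∫⁻ τ in Ioo t₀ T, A *
            (blockL2 (u τ) j * ∑ m ∈ Finset.Icc (-2 : ℤ) 2, blockL2 (u τ) ((j : ℤ) + m) *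
                paraT (fun l => (2 : ℝ≥0∞) ^ l * blockSup (u τ) l) ((j : ℤ) + m) +
              blockSup (u τ) j * paraQ2 (blockL2 (u τ)) (fun l => (2 : ℝ≥0∞) ^ l * blockL2 (u τ) l) j) := by
  obtain ⟨c, hc, H⟩ := transfer_floor
  set K := lpBounds (Fin 3) with hK
  obtain ⟨Csup, hCsup⟩ := exists_eLpNorm_top_fderiv_blockFn_le (E := EuclideanSpace ℝ (Fin 3)) (ι := Fin 3)
  obtain ⟨CL, hCL⟩ := exists_lipschitz_blockFn_le (E := EuclideanSpace ℝ (Fin 3)) (ι := Fin 3)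
  set d : ℝ≥0∞ := (Fintype.card (Fin (Module.finrank ℝ (EuclideanSpace ℝ (Fin 3)))) : ℝ≥0∞) with hd
  set M₁ : ℝ≥0∞ := ENNReal.ofReal
    (∫ z : EuclideanSpace ℝ (Fin 3), ‖blockKernel (EuclideanSpace ℝ (Fin 3)) 0 z‖ * ‖z‖) with hM₁
  set C₁ : ℝ≥0∞ := ∫⁻ z, ‖blockKernel (EuclideanSpace ℝ (Fin 3)) 0 z‖ₑ with hC₁
  have hC₁top : C₁ ≠ ∞ := (integrable_blockKernel (E := EuclideanSpace ℝ (Fin 3)) 0).2.ne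
  have hdtop : d ≠ ∞ := ENNReal.natCast_ne_top _
  set A₁₂ : ℝ≥0∞ := d * (4 * d * CL * M₁ * K.Cb + 64 * K.C₂ * K.Cb) + d * K.C₂ * Csup with hA₁₂
  set A₃ : ℝ≥0∞ := d * C₁ * K.Cb with hA₃
  have hA₁₂top : A₁₂ ≠ ∞ := by
    refine ENNReal.add_ne_top.2 ⟨ENNReal.mul_ne_top hdtop (ENNReal.add_ne_top.2 ⟨?_, ?_⟩), ?_⟩
    · exact ENNReal.mul_ne_top (ENNReal.mul_ne_top (ENNReal.mul_ne_top (ENNReal.mul_ne_top (by norm_num) hdtop)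
        ENNReal.coe_ne_top) ENNReal.ofReal_ne_top) ENNReal.coe_ne_top
    · exact ENNReal.mul_ne_top (ENNReal.mul_ne_top (by norm_num) ENNReal.coe_ne_top) ENNReal.coe_ne_top
    · exact ENNReal.mul_ne_top (ENNReal.mul_ne_top hdtop ENNReal.coe_ne_top) ENNReal.coe_ne_top
  have hA₃top : A₃ ≠ ∞ := ENNReal.mul_ne_top (ENNReal.mul_ne_top hdtop hC₁top) ENNReal.coe_ne_top
  refine ⟨c, A₁₂ + A₃, hc, ENNReal.add_ne_top.2 ⟨hA₁₂top, hA₃top⟩,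
    fun ν T hν hT u p hmax hLH t₀ ht₀ => ?_⟩
  refine (H ν T hν hT u p hmax hLH t₀ ht₀).mono fun j hj => hj.trans ?_
  gcongr (2 : ℝ≥0∞) ^ j * ?_
  refine setLIntegral_mono' measurableSet_Ioo fun τ hτ => ?_
  have hτT : τ ∈ Ioo 0 T := ⟨ht₀.1.trans_lt hτ.1, hτ.2⟩
  have hw : IsSmoothL2Field (u τ) := isSmoothL2Field_slice_of_maximal hν hT hmax hLH hτT
  have hdiv : VectorCalculus.IsDivFree (u τ) := hmax.1.divFree τ ⟨hτT.1.le, hτT.2⟩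
  have h36 := enorm_integral_inner_blockFn_convect_le_lowMode K hCsup hCL hw hdiv (j : ℤ)
  calc ENNReal.ofReal (-(∫ x, ⟪blockFn (j : ℤ) (u τ) x, blockFn (j : ℤ) (convect (u τ) (u τ)) x⟫))
      ≤ ‖∫ x, ⟪blockFn (j : ℤ) (u τ) x, blockFn (j : ℤ) (convect (u τ) (u τ)) x⟫‖ₑ := by
        rw [← ofReal_norm, Real.norm_eq_abs]
        exact ENNReal.ofReal_le_ofReal (neg_le_abs _)
    _ ≤ A₁₂ * (blockL2 (u τ) j * ∑ m ∈ Finset.Icc (-2 : ℤ) 2, blockL2 (u τ) ((j : ℤ) + m) *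
            paraT (fun l => (2 : ℝ≥0∞) ^ l * blockSup (u τ) l) ((j : ℤ) + m)) +
        A₃ * (blockSup (u τ) j * paraQ2 (blockL2 (u τ)) (fun l => (2 : ℝ≥0∞) ^ l * blockL2 (u τ) l) j) := h36
    _ ≤ (A₁₂ + A₃) * (blockL2 (u τ) j * ∑ m ∈ Finset.Icc (-2 : ℤ) 2, blockL2 (u τ) ((j : ℤ) + m) *
            paraT (fun l => (2 : ℝ≥0∞) ^ l * blockSup (u τ) l) ((j : ℤ) + m)) +
        (A₁₂ + A₃) * (blockSup (u τ) j *
          paraQ2 (blockL2 (u τ)) (fun l => (2 : ℝ≥0∞) ^ l * blockL2 (u τ) l) j) := by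
        gcongr
        · exact le_self_add
        · exact le_add_self
    _ = (A₁₂ + A₃) * (blockL2 (u τ) j * ∑ m ∈ Finset.Icc (-2 : ℤ) 2, blockL2 (u τ) ((j : ℤ) + m) *
            paraT (fun l => (2 : ℝ≥0∞) ^ l * blockSup (u τ) l) ((j : ℤ) + m) +
          blockSup (u τ) j * paraQ2 (blockL2 (u τ)) (fun l => (2 : ℝ≥0∞) ^ l * blockL2 (u τ) l) j) :=
        (mul_add _ _ _).symm

/-! ## L12″ — the transfer ceiling: a block's energy grows only through the two local channels -/

/-- **L12″ — THE TRANSFER CEILING (companion of the floor).** There is an absolute FINITE constant `A` (the same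
Littlewood–Paley constant as in `transfer_floor_local`) such that for every `ν > 0`, `T > 0`, every maximal smooth
solution `(u, p)` of the unforced Navier–Stokes system on `ℝ³ × [0, T)` which is Leray–Hopf from `u 0`, all times
`0 < s ≤ t < T` and EVERY level `j ∈ ℤ`:
`‖Δ̇_j u(t)‖₂² ≤ ‖Δ̇_j u(s)‖₂² + 2 ∫⁻_{(s,t]} A·( a_j ∑_{|m|≤2} a_{j+m} T_{j+m} + s_j Q_j )(τ) dτ`
(notation of `transfer_floor_local`: `a_l = ‖Δ̇_l u(τ)‖₂`, `s_l = ‖Δ̇_l u(τ)‖_∞`, `T_l = ∑_{l'≤l-3} 2^{l'} s_{l'}` the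
Lipschitz size of all coarser levels, `Q_j = ∑_{l≥j-4,|m|≤2} a_l 2^{l+m} a_{l+m}` the weighted energy pairs of
comparable-or-finer levels). This is the covered transport inequality `BlockEnergyTransport.blockL2_sq_le_add_transfer`
with the transfer term bounded slice by slice by the Cheskidov–Dai low-mode form of the block balance
(`enorm_integral_inner_blockFn_convect_le_lowMode`, (3.6); smooth slices by `isSmoothL2Field_slice_of_maximal`). Cascade
reading (a statement about every level and every pair of times, not only about the tail): the energy handed INTO a
level between two times is at most what the LOCAL PAIR channel (own `L²` amplitude × a neighbour's × coarse strain) and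
the FINE PAIR channel (own sup amplitude × finer energy pairs) can carry in that time — the block's own amplitude is a
factor of every term, so a level grows at most at the rate set by its neighbours and the coarse strain, never by a jump
fed from a distance; together with `transfer_floor` the two channels must nevertheless deliver `c ν² 2^{-j}` at
infinitely many levels in every terminal window. Necessity/ceiling only; nothing about sufficiency.
[cite: CheskidovDai2015, §3.1 (3.6)] -/
theorem blockL2_sq_le_add_local :
    ∃ A : ℝ≥0∞, A ≠ ∞ ∧ ∀ (ν T : ℝ), 0 < ν → 0 < T →
      ∀ (u : ℝ → EuclideanSpace ℝ (Fin 3) → EuclideanSpace ℝ (Fin 3)) (p : ℝ → EuclideanSpace ℝ (Fin 3) → ℝ),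
      IsMaximalSmoothSolution ν 0 u p T → IsLerayHopfOn T ν 0 (u 0) u →
      ∀ s t : ℝ, 0 < s → s ≤ t → t < T → ∀ j : ℤ,
        blockL2 (u t) j ^ 2 ≤ blockL2 (u s) j ^ 2 +
          2 * ∫⁻ τ in Ioc s t, A *
            (blockL2 (u τ) j * ∑ m ∈ Finset.Icc (-2 : ℤ) 2, blockL2 (u τ) (j + m) *
                paraT (fun l => (2 : ℝ≥0∞) ^ l * blockSup (u τ) l) (j + m) +
              blockSup (u τ) j * paraQ2 (blockL2 (u τ)) (fun l => (2 : ℝ≥0∞) ^ l * blockL2 (u τ) l) j) := by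
  set K := lpBounds (Fin 3) with hK
  obtain ⟨Csup, hCsup⟩ := exists_eLpNorm_top_fderiv_blockFn_le (E := EuclideanSpace ℝ (Fin 3)) (ι := Fin 3)
  obtain ⟨CL, hCL⟩ := exists_lipschitz_blockFn_le (E := EuclideanSpace ℝ (Fin 3)) (ι := Fin 3)
  set d : ℝ≥0∞ := (Fintype.card (Fin (Module.finrank ℝ (EuclideanSpace ℝ (Fin 3)))) : ℝ≥0∞) with hd
  set M₁ : ℝ≥0∞ := ENNReal.ofReal
    (∫ z : EuclideanSpace ℝ (Fin 3), ‖blockKernel (EuclideanSpace ℝ (Fin 3)) 0 z‖ * ‖z‖) with hM₁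
  set C₁ : ℝ≥0∞ := ∫⁻ z, ‖blockKernel (EuclideanSpace ℝ (Fin 3)) 0 z‖ₑ with hC₁
  have hC₁top : C₁ ≠ ∞ := (integrable_blockKernel (E := EuclideanSpace ℝ (Fin 3)) 0).2.ne
  have hdtop : d ≠ ∞ := ENNReal.natCast_ne_top _
  set A₁₂ : ℝ≥0∞ := d * (4 * d * CL * M₁ * K.Cb + 64 * K.C₂ * K.Cb) + d * K.C₂ * Csup with hA₁₂
  set A₃ : ℝ≥0∞ := d * C₁ * K.Cb with hA₃
  have hA₁₂top : A₁₂ ≠ ∞ := by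
    refine ENNReal.add_ne_top.2 ⟨ENNReal.mul_ne_top hdtop (ENNReal.add_ne_top.2 ⟨?_, ?_⟩), ?_⟩
    · exact ENNReal.mul_ne_top (ENNReal.mul_ne_top (ENNReal.mul_ne_top (ENNReal.mul_ne_top (by norm_num) hdtop)
        ENNReal.coe_ne_top) ENNReal.ofReal_ne_top) ENNReal.coe_ne_top
    · exact ENNReal.mul_ne_top (ENNReal.mul_ne_top (by norm_num) ENNReal.coe_ne_top) ENNReal.coe_ne_top
    · exact ENNReal.mul_ne_top (ENNReal.mul_ne_top hdtop ENNReal.coe_ne_top) ENNReal.coe_ne_top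
  have hA₃top : A₃ ≠ ∞ := ENNReal.mul_ne_top (ENNReal.mul_ne_top hdtop hC₁top) ENNReal.coe_ne_top
  refine ⟨A₁₂ + A₃, ENNReal.add_ne_top.2 ⟨hA₁₂top, hA₃top⟩,
    fun ν T hν hT u p hmax hLH s t hs hst htT j => ?_⟩
  refine (blockL2_sq_le_add_transfer hν hT hmax hLH hs hst htT j).trans ?_
  gcongr blockL2 (u s) j ^ 2 + 2 * ?_
  refine setLIntegral_mono' measurableSet_Ioc fun τ hτ => ?_
  have hτT : τ ∈ Ioo 0 T := ⟨hs.trans hτ.1, hτ.2.trans_lt htT⟩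
  have hw : IsSmoothL2Field (u τ) := isSmoothL2Field_slice_of_maximal hν hT hmax hLH hτT
  have hdiv : VectorCalculus.IsDivFree (u τ) := hmax.1.divFree τ ⟨hτT.1.le, hτT.2⟩
  have h36 := enorm_integral_inner_blockFn_convect_le_lowMode K hCsup hCL hw hdiv j
  calc ENNReal.ofReal (-(∫ x, ⟪blockFn j (u τ) x, blockFn j (convect (u τ) (u τ)) x⟫))
      ≤ ‖∫ x, ⟪blockFn j (u τ) x, blockFn j (convect (u τ) (u τ)) x⟫‖ₑ := by
        rw [← ofReal_norm, Real.norm_eq_abs]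
        exact ENNReal.ofReal_le_ofReal (neg_le_abs _)
    _ ≤ A₁₂ * (blockL2 (u τ) j * ∑ m ∈ Finset.Icc (-2 : ℤ) 2, blockL2 (u τ) (j + m) *
            paraT (fun l => (2 : ℝ≥0∞) ^ l * blockSup (u τ) l) (j + m)) +
        A₃ * (blockSup (u τ) j * paraQ2 (blockL2 (u τ)) (fun l => (2 : ℝ≥0∞) ^ l * blockL2 (u τ) l) j) := h36
    _ ≤ (A₁₂ + A₃) * (blockL2 (u τ) j * ∑ m ∈ Finset.Icc (-2 : ℤ) 2, blockL2 (u τ) (j + m) *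
            paraT (fun l => (2 : ℝ≥0∞) ^ l * blockSup (u τ) l) (j + m)) +
        (A₁₂ + A₃) * (blockSup (u τ) j *
          paraQ2 (blockL2 (u τ)) (fun l => (2 : ℝ≥0∞) ^ l * blockL2 (u τ) l) j) := by
        gcongr
        · exact le_self_add
        · exact le_add_self
    _ = (A₁₂ + A₃) * (blockL2 (u τ) j * ∑ m ∈ Finset.Icc (-2 : ℤ) 2, blockL2 (u τ) (j + m) *
            paraT (fun l => (2 : ℝ≥0∞) ^ l * blockSup (u τ) l) (j + m) +
          blockSup (u τ) j * paraQ2 (blockL2 (u τ)) (fun l => (2 : ℝ≥0∞) ^ l * blockL2 (u τ) l) j) :=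
        (mul_add _ _ _).symm

end Summit.NavierStokesRegularity.FluidComputer.LevelTransferFloor

end
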